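import Summits.MatrixMultiplication.MatrixMultiplication.Theorems.SoloInformedLadderSqueeze
import HarnessLib

/-!
# A left rung pays an `ω`-bound: `R̃(⟨3,3,2⟩) = 9 ⟹ ω ≤ 2.3378` (given VWXXZ 2024 Table 1)

Solo-informed seat, gen 31 (s1, fourth file).  `SoloInformedLadderSqueeze.lean` interpolates the
convex function `q ↦ ω(1,1,q)` at `q = 1` between a left rung and a right RUNG; here the right end
is instead a KNOWN rectangular upper bound `ω(1,1,k) ≤ u` (a row of VWXXZ 2024 Table 1, the tree's
named fact `vxxz2024_omegaRect_table`):

* `omega_le_of_left_rung_of_omegaRect_le`: `ω(1,a,1) = 2`, `ω(1,1,k) ≤ u` (`0 ≤ a ≤ 1 < k`) give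
  `ω ≤ (2(k−1) + (1−a)u)/(k−a)`;
* `omega_le_of_rung_three_of_table`: over `ℂ`, LEFT RUNG 3 ALONE (`ω(1, log_3 2, 1) = 2`, i.e.
  `R̃(⟨3,3,2⟩) ≤ 9`, tensor form `omega_le_of_asymptoticRank_332_le_of_table`) with the row
  `ω(1,2,1) ≤ 3.250385` gives `ω ≤ (2 + (1 − log_3 2)·3.250385)/(2 − log_3 2) ≤ 2.3378 < 2.371339`:
  the single small-tensor statement "the `9 × 6 × 6` tensor `⟨3,3,2⟩` has asymptotic rank `9`" would
  by itself improve the exponent of matrix multiplication below the laser-method record.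
  (Break-even, bookkeeping: with today's right-side rows a left rung `a` pays against `2.371339` iff
  `a ≳ 0.578` (row `k = 2`; `≈ 0.54` with row `k = 1.1`), i.e. only rung 3 of the lopsided ladder pays;
  rung 4 (`a = 1/2`) gives `2.3767` at best.  The CW_q α-barrier is `5/8 = 0.625 > 0.578`, so an
  α-certificate inside the barrier could in principle still pay — none is known above `0.321334`.)

[cite: LottiRomani1983, §2 (p. 174)] [cite: VassilevskaWilliamsXuXuZhou2024, §1.1 Table 1]
-/

set_option linter.dupNamespace false

namespace Summit.MatrixMultiplication.MatrixMultiplication.Theorems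

open Literature.Computability.AlgebraicComplexity

variable (K : Type) [Field K]

/-- **A left rung and a right-side upper bound give an `ω`-bound** (convexity at `q = 1`):
`ω(1,a,1) = 2`, `ω(1,1,k) ≤ u`, `0 ≤ a ≤ 1 < k` ⟹ `ω ≤ (2(k−1) + (1−a)u)/(k−a)`.
[cite: LottiRomani1983, §2 (p. 174)] -/
theorem omega_le_of_left_rung_of_omegaRect_le {a k u : ℝ} (ha0 : 0 ≤ a) (ha1 : a ≤ 1) (hk : 1 < k)
    (hleft : omegaRect K 1 a 1 = 2) (hu : omegaRect K 1 1 k ≤ u) :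
    omega K ≤ (2 * (k - 1) + (1 - a) * u) / (k - a) := by
  have hka : 0 < k - a := by linarith
  have h := omega_le_convexComb_omegaRect K ha0 ha1 hk
  rw [omegaRect_one_mid_one] at hleft
  rw [hleft] at h
  refine h.trans ?_
  rw [div_le_div_iff_of_pos_right hka]
  nlinarith [mul_le_mul_of_nonneg_left hu (sub_nonneg.2 ha1)]

/-- Over `ℂ`, given VWXXZ 2024 Table 1 (row `ω(1,2,1) ≤ 3.250385`): **left rung 3 alone gives
`ω ≤ 2.3378`** — `ω(1, log_3 2, 1) = 2 ⟹ ω ≤ (2 + (1 − 0.63)·3.250385)/(2 − 0.63)… ≤ 2.3378 < 2.371339`.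
[cite: VassilevskaWilliamsXuXuZhou2024, §1.1 Table 1] -/
theorem omega_le_of_rung_three_of_table (hT : vxxz2024_omegaRect_table)
    (h3 : omegaRect ℂ 1 (Real.logb 3 2) 1 = 2) : omega ℂ ≤ 2.3378 := by
  have hl1 : Real.logb 3 2 ≤ 1 := by
    rw [Real.logb_le_iff_le_rpow (by norm_num) (by norm_num)]
    norm_num
  have hl : (0.63 : ℝ) ≤ Real.logb 3 2 := logb_three_two_ge
  have hl0 : 0 ≤ Real.logb 3 2 := le_trans (by norm_num) hl
  have hu : omegaRect ℂ 1 1 2 ≤ 3.250385 := by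
    have := hT 2 3.250385 (by norm_num [vxxz2024Table])
    rwa [omegaRect_one_mid_one] at this
  have h := omega_le_of_left_rung_of_omegaRect_le ℂ hl0 hl1 (by norm_num : (1 : ℝ) < 2) h3 hu
  have hka : (0 : ℝ) < 2 - Real.logb 3 2 := by linarith
  rw [le_div_iff₀ hka] at h
  by_contra hc
  push Not at hc
  have h2 : 2.3378 * (2 - Real.logb 3 2) < omega ℂ * (2 - Real.logb 3 2) :=
    mul_lt_mul_of_pos_right hc hka
  nlinarith

/-- Tensor form: over `ℂ`, given VWXXZ 2024 Table 1, **`R̃(⟨3,3,2⟩) ≤ 9 ⟹ ω ≤ 2.3378`**.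
[cite: VassilevskaWilliamsXuXuZhou2024, §1.1 Table 1] -/
theorem omega_le_of_asymptoticRank_332_le_of_table (hT : vxxz2024_omegaRect_table)
    (h3 : asymptoticRank (matMulTensor ℂ 3 3 2) ≤ 9) : omega ℂ ≤ 2.3378 := by
  have h := (asymptoticRank_lopsided_le_sq_iff_omegaRect ℂ (by norm_num : 2 ≤ 3)).1
    (by norm_num; exact h3)
  rw [Nat.cast_ofNat] at h
  exact omega_le_of_rung_three_of_table hT h

/-- For contrast: **left rung 4 (`ω(1, 1/2, 1) = 2`, i.e. `R̃(⟨4,4,2⟩) ≤ 16`) pays nothing** with the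
row `k = 2`: the bound is only `(2 + 3.250385/2)/(3/2) = 2.4168…` (here `≤ 2.4169`).
[cite: VassilevskaWilliamsXuXuZhou2024, §1.1 Table 1] -/
theorem omega_le_of_rung_four_of_table (hT : vxxz2024_omegaRect_table)
    (h4 : omegaRect ℂ 1 (1 / 2) 1 = 2) : omega ℂ ≤ 2.4169 := by
  have hu : omegaRect ℂ 1 1 2 ≤ 3.250385 := by
    have := hT 2 3.250385 (by norm_num [vxxz2024Table])
    rwa [omegaRect_one_mid_one] at this
  have h := omega_le_of_left_rung_of_omegaRect_le ℂ (by norm_num : (0 : ℝ) ≤ 1 / 2)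
    (by norm_num : (1 : ℝ) / 2 ≤ 1) (by norm_num : (1 : ℝ) < 2) h4 hu
  have e : (2 * (2 - 1) + (1 - 1 / 2) * 3.250385) / (2 - 1 / 2) ≤ (2.4169 : ℝ) := by norm_num
  exact h.trans e

end Summit.MatrixMultiplication.MatrixMultiplication.Theorems
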